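import Literature.Probability.Percolation.SemicircuitDomain
import Literature.Probability.LatticeModels.StripWetting
import Literature.Probability.LatticeModels.LineTouching
import Literature.Probability.LatticeModels.IsingGibbsMixture
import HarnessLib

/-!
# The point-to-semicircuit lemma (Georgii–Higuchi 2000, Lemma 2.3)

Topic `Probability/LatticeModels`. Georgii–Higuchi, J. Math. Phys. 41 (2000), Lemma 2.3
(Point-to-semicircuit lemma): "Let `π` be a half-plane with boundary line `ℓ`, `x ∈ ℓ`, and `σ` a
`∗`semicircuit in `π` with interior `Λ = Int σ ∋ x`. Let `ω ∈ Ω` be such that `ω ≡ +1` on `σ`.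
Then `μ^ω_Λ(x` is `+∗`connected to `σ) ≥ θ/2`, where `θ = μ⁺(0 ∈ I^{+∗}) > 0`."

We prove it, for the upper half-plane and the horizontal axis, in the circuit-free form used in
the sequel: `Λ` is any finite **hole-free** domain invariant under the reflection `R` in the axis
(`Int σ ∪ R(Int σ)` in GH), the boundary condition is `η±` (`+1` on and above the axis, `-1`
below: by stochastic monotonicity this is the least favourable case of "`+` on `σ`, anything on
`R σ`"), and "`x` is `+∗`connected to `σ`" is the event `x ∈ kSet Λ σ 1` of `OnionDichotomy`
(`x` is joined inside `Λ` by `+`sites to a site `∗`-adjacent to the outside on or above the axis):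

* **`pointToSemicircuit`** — `μ^{η±}_Λ(x ∈ kSet 1) ≥ θ/2` with
  `θ = μ{x belongs to an infinite +∗cluster}` for ANY `μ ∈ 𝒢(β, 0)` (in particular GH's
  `θ = μ⁺(x ∈ I^{+∗})`).

Proof as in GH (pp. 5–6): with `D = B ∪ C` (`B = {x ∈ kSet 1}`, `C = {x ∈ Γ⁺}`, `Γ⁺` the random
volume `onionDomain` of `SemicircuitDomain`), (1) `μ(D ∪ R∘T(D)) = 1` is the onion dichotomy
(`onion_dichotomy'`, with `R∘T(D) = {x ∈ kSet (-1)} ∪ {x ∈ Γ⁻}` by the transport lemmas);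
(2) `μ ≽ μ ∘ R∘T` since `η± ≥ R∘T(η±)` (`isingExpect_fixed_flipRelabel`, `isingExpect_fixed_mono`),
so `μ(D) ≥ 1/2` as `D` is increasing; (3) `μ(B ∩ C) ≥ θ μ(C)` by the Markov property on the random
volume `Γ⁺` (determined from outside: `onionDomain_eq_of_eq_off`; DLR consistency of the
finite-volume kernels `isingMeasure_fixed_inter_eq_lintegral`): on `{Γ⁺ = G}` the kernel `μ^σ_G`
has `+` spins on `∂G`, so `μ^σ_G(x` joined in `G` to `∂^∗G) = μ^+_G(·) ≥ μ(·) ≥ θ`, and that event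
implies `B`; (4) `μ(B) ≥ μ(B∖C) + μ(B ∩ C) ≥ θ μ(D) ≥ θ/2`.

## References

* H.-O. Georgii, Y. Higuchi, J. Math. Phys. 41 (2000), Lemma 2.3 (pp. 5–6) [GeorgiiHiguchi2000].
-/

noncomputable section

open MeasureTheory Filter Finset SimpleGraph
open Literature.Probability.Percolation
open scoped ENNReal

namespace Literature.Probability.LatticeModels

variable {β : ℝ} {Λ : Finset (Site 2)} {x : Site 2}

/-! ### The flip-reflection in the axis and the boundary condition `η±` -/

/-- The inverse of the axis reflection is itself. [folklore] -/
theorem reflectCoord_one_symm_apply (z : Site 2) : (reflectCoord (d := 2) 1).toEquiv.symm z = reflectCoord 1 z := by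
  rw [Equiv.symm_apply_eq]; exact (reflectCoord_reflectCoord 1 z).symm

/-- `R∘T` of `FlipReflectionDomination` is the colouring transform of `SemicircuitDomain`. [folklore] -/
theorem flipRelabel_reflectCoord_one (σ : SpinConfig (Site 2)) :
    flipRelabel (reflectCoord (d := 2) 1).toEquiv σ = flipReflectColour σ := by
  funext z
  rw [flipRelabel_apply, reflectCoord_one_symm_apply]; rfl

/-- `η± ≥ R∘T(η±)` (they differ only on the axis). [cite: GeorgiiHiguchi2000, Lemma 2.3 (proof)] -/
theorem flipRelabel_pmBC_le : flipRelabel (reflectCoord (d := 2) 1).toEquiv (pmBC 0) ≤ pmBC 0 := by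
  intro z
  rw [flipRelabel_reflectCoord_one]
  simp only [flipReflectColour, pmBC, Rf_apply_one]
  by_cases h0 : 0 ≤ z 1
  · rw [if_pos h0]; exact intUnits_le_one _
  · have : (0 : ℤ) ≤ -z 1 := by omega
    rw [if_pos this, if_neg h0]

/-- An `R`-invariant volume, `Finset.map` form. [folklore] -/
theorem map_reflectCoord_one_eq (hΛR : ∀ z, z ∈ Λ ↔ reflectCoord 1 z ∈ Λ) :
    Λ.map (reflectCoord (d := 2) 1).toEquiv.toEmbedding = Λ := by
  ext z
  rw [mem_map_toEmbedding_iff, reflectCoord_one_symm_apply]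
  exact (hΛR z).symm

/-- **Flip-reflection domination in the symmetric volume with boundary condition `η±`**: for a
nondecreasing measurable `f`, `∫ f ∘ R∘T dμ^{η±}_Λ ≤ ∫ f dμ^{η±}_Λ` (GH Lemma 2.2, finite volume:
`μ^{η±}_Λ(f ∘ R∘T) = μ^{R∘T η±}_Λ(f) ≤ μ^{η±}_Λ(f)`). [cite: GeorgiiHiguchi2000, Lemma 2.2] -/
theorem integral_comp_flipRelabel_le (hβ : 0 ≤ β) (hΛR : ∀ z, z ∈ Λ ↔ reflectCoord 1 z ∈ Λ)
    {f : SpinConfig (Site 2) → ℝ} (hf : Monotone f) (hfm : Measurable f) :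
    ∫ σ, f (flipRelabel (reflectCoord (d := 2) 1).toEquiv σ) ∂(isingMeasure (zdGraph 2) Λ β 0 (.fixed (pmBC 0))) ≤
      ∫ σ, f σ ∂(isingMeasure (zdGraph 2) Λ β 0 (.fixed (pmBC 0))) := by
  have h1 := isingExpect_fixed_flipRelabel (reflectCoord (d := 2) 1) (map_reflectCoord_one_eq hΛR) β (pmBC 0) hfm
  change isingExpect (zdGraph 2) Λ β 0 (.fixed (pmBC 0)) (f ∘ flipRelabel (reflectCoord (d := 2) 1).toEquiv) ≤
    isingExpect (zdGraph 2) Λ β 0 (.fixed (pmBC 0)) f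
  rw [← h1]
  exact isingExpect_fixed_mono (zdGraph 2) hβ Λ 0 flipRelabel_pmBC_le hf hfm

/-! ### The events -/

/-- Events decided by the spins in `Λ` are measurable. [folklore] -/
theorem measurableSet_of_forall_eq_on (Λ : Finset (Site 2)) {A : Set (SpinConfig (Site 2))}
    (h : ∀ σ σ' : SpinConfig (Site 2), (∀ v ∈ Λ, σ v = σ' v) → (σ ∈ A ↔ σ' ∈ A)) : MeasurableSet A :=
  cylinderEvents_le_pi _ (measurableSet_cylinderEvents_of_forall_eq (K := Λ) h)

/-- The event `B = {x ∈ kSet 1}` ("`x` is `+∗`connected to `σ`") is measurable. [folklore] -/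
theorem measurableSet_kSet (Λ : Finset (Site 2)) (x : Site 2) (s : ℤˣ) :
    MeasurableSet {σ : SpinConfig (Site 2) | x ∈ kSet Λ σ s} :=
  measurableSet_of_forall_eq_on Λ fun σ σ' h => by simp only [Set.mem_setOf_eq, kSet_eq_of_eqOn h s]

/-- The event `C = {x ∈ Γ_s}` is measurable. [folklore] -/
theorem measurableSet_onionDomain (Λ : Finset (Site 2)) (x : Site 2) (s : ℤˣ) :
    MeasurableSet {σ : SpinConfig (Site 2) | x ∈ onionDomain Λ σ s} :=
  measurableSet_of_forall_eq_on Λ fun σ σ' h => by simp only [Set.mem_setOf_eq, onionDomain_eq_of_eqOn h s]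

/-- `+`sites are preserved upwards. [folklore] -/
theorem plus_of_le {σ σ' : SpinConfig (Site 2)} (h : σ ≤ σ') (v : Site 2) (hv : σ v = 1) : σ' v = 1 :=
  intUnits_eq_one_of_one_le (hv ▸ h v)

/-- The event `D⁺ = B ∪ C` is increasing. [cite: GeorgiiHiguchi2000, Lemma 2.3 (proof)] -/
theorem isUpperSet_kSet_union_onionDomain (Λ : Finset (Site 2)) (x : Site 2) :
    IsUpperSet {σ : SpinConfig (Site 2) | x ∈ kSet Λ σ 1 ∨ x ∈ onionDomain Λ σ 1} := by
  intro σ σ' hle h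
  rcases h with h | h
  · exact Or.inl (kSet_mono (plus_of_le hle) h)
  · exact Or.inr (onionDomain_mono (plus_of_le hle) h)

/-! ### The lower bound `θ` on the random volume -/

section Theta

/-- The `G`-local increasing event "`x` is joined inside `G` by `+`sites to a site of `G` adjacent to
the outside of `G`". [cite: GeorgiiHiguchi2000, Lemma 2.3 (proof)] -/
def innerConn (G : Finset (Site 2)) (x : Site 2) : Set (SpinConfig (Site 2)) :=
  {ζ | ζ x = 1 ∧ ∃ g ∈ G, (∃ w, w ∉ G ∧ zdStarGraph.Adj g w) ∧ (siteOpenGraph zdStarGraph ({v | ζ v = 1} ∩ ↑G)).Reachable x g}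

/-- `innerConn` depends only on the spins in `G`. [folklore] -/
theorem innerConn_congr {G : Finset (Site 2)} {x : Site 2} (hx : x ∈ G) {ζ ζ' : SpinConfig (Site 2)} (h : ∀ v ∈ G, ζ v = ζ' v) :
    ζ ∈ innerConn G x ↔ ζ' ∈ innerConn G x := by
  have hO : {v | ζ v = 1} ∩ (↑G : Set (Site 2)) = {v | ζ' v = 1} ∩ ↑G := by
    ext v; simp only [Set.mem_inter_iff, Set.mem_setOf_eq, Finset.mem_coe]
    constructor
    · rintro ⟨h1, h2⟩; exact ⟨by rw [← h v h2]; exact h1, h2⟩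
    · rintro ⟨h1, h2⟩; exact ⟨by rw [h v h2]; exact h1, h2⟩
  simp only [innerConn, Set.mem_setOf_eq, hO, h x hx]

/-- `innerConn` is measurable. [folklore] -/
theorem measurableSet_innerConn (G : Finset (Site 2)) (hx : x ∈ G) : MeasurableSet (innerConn G x) :=
  measurableSet_of_forall_eq_on G fun _ _ h => innerConn_congr hx h

/-- `innerConn` is increasing. [folklore] -/
theorem isUpperSet_innerConn (G : Finset (Site 2)) (x : Site 2) : IsUpperSet (innerConn G x) := by
  rintro ζ ζ' hle ⟨hζx, g, hg, hw, hr⟩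
  refine ⟨plus_of_le hle x hζx, g, hg, hw, hr.mono (siteOpenGraph_mono _ fun v hv => ⟨plus_of_le hle v hv.1, hv.2⟩)⟩

/-- An infinite `+∗`cluster through `x ∈ G` realises `innerConn G x` (first exit from `G`). [folklore] -/
theorem innerConn_of_infinite {G : Finset (Site 2)} {x : Site 2} (hx : x ∈ G) {ζ : SpinConfig (Site 2)}
    (hinf : (siteCluster zdStarGraph (spinSites 1 ζ) x).Infinite) : ζ ∈ innerConn G x := by
  obtain ⟨y, hy, hyG⟩ : ∃ y ∈ siteCluster zdStarGraph (spinSites 1 ζ) x, y ∉ G := by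
    by_contra h; push Not at h
    exact hinf (G.finite_toSet.subset fun y hy => h y hy)
  obtain ⟨-, -, ⟨p⟩⟩ := hy
  obtain ⟨a, b, ha, hb, hab, -, hreach⟩ := exists_adj_reachable_withinGraph_of_walk
    (siteOpenGraph zdStarGraph (spinSites 1 ζ)) p (S := (↑G : Set (Site 2))) (Finset.mem_coe.2 hx)
    ⟨y, Walk.end_mem_support p, fun h => hyG (Finset.mem_coe.1 h)⟩
  have hab' := (siteOpenGraph_adj _ _ _ _).1 hab
  refine ⟨mem_spinSites_of_infiniteOf hinf, a, Finset.mem_coe.1 ha, ⟨b, fun h => hb (Finset.mem_coe.2 h), hab'.1⟩, ?_⟩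
  refine hreach.mono fun u v huv => ?_
  rw [withinGraph_adj, siteOpenGraph_adj] at huv
  rw [siteOpenGraph_adj]
  exact ⟨huv.1.1, ⟨huv.1.2.1, huv.2.1⟩, ⟨huv.1.2.2, huv.2.2⟩⟩

/-- **`μ^{+}_G(innerConn) ≥ θ`** for every Gibbs measure `μ`: `μ(x` percolates`) ≤ μ(innerConn) =
∫ μ^ω_G(innerConn) dμ ≤ μ^+_G(innerConn)`. [cite: GeorgiiHiguchi2000, Lemma 2.3 (proof)] -/
theorem measureReal_infinite_le_isingExpect_plus (hβ : 0 ≤ β) {μ : Measure (SpinConfig (Site 2))}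
    (hμ : μ ∈ isingGibbsMeasures 2 β 0) (G : Finset (Site 2)) (hx : x ∈ G) :
    μ.real {ω | (siteCluster zdStarGraph (spinSites 1 ω) x).Infinite} ≤
      (isingMeasure (zdGraph 2) G β 0 (.fixed fun _ => 1)).real (innerConn G x) := by
  have hμG : IsGibbsMeasure (isingSpecification (zdGraph 2) β 0) μ := hμ
  haveI := hμG.isProbabilityMeasure
  have hAm := measurableSet_innerConn G hx
  calc μ.real {ω | (siteCluster zdStarGraph (spinSites 1 ω) x).Infinite}
      ≤ μ.real (innerConn G x) := measureReal_mono fun ω hω => innerConn_of_infinite hx hω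
    _ = ∫ η, (isingMeasure (zdGraph 2) G β 0 (.fixed η)).real (innerConn G x) ∂μ :=
        measureReal_eq_integral_of_dlr hμG.2 G hAm
    _ ≤ ∫ _η, (isingMeasure (zdGraph 2) G β 0 (.fixed fun _ => 1)).real (innerConn G x) ∂μ := by
        refine integral_mono_of_nonneg (Eventually.of_forall fun η => measureReal_nonneg) (integrable_const _)
          (Eventually.of_forall fun η => ?_)
        have hmono : Monotone ((innerConn G x).indicator (1 : SpinConfig (Site 2) → ℝ)) :=
          monotone_indicator_one_of_isUpperSet (isUpperSet_innerConn G x)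
        have := isingExpect_fixed_mono (zdGraph 2) hβ G 0 (show η ≤ fun _ => 1 from fun v => intUnits_le_one _)
          hmono (measurable_one.indicator hAm)
        simp only [isingExpect, integral_indicator_one hAm] at this
        exact this
    _ = (isingMeasure (zdGraph 2) G β 0 (.fixed fun _ => 1)).real (innerConn G x) := by
        rw [integral_const, smul_eq_mul, probReal_univ, one_mul]

end Theta

/-! ### The lemma -/

/-- **Georgii–Higuchi 2000, Lemma 2.3 (Point-to-semicircuit lemma)**, circuit-free form: for
`β ≥ 0`, a finite hole-free domain `Λ ⊆ ℤ²` invariant under the reflection in the horizontal axis,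
a site `x ∈ Λ` on the axis, and the boundary condition `η±` (`+1` on and above the axis, `-1`
below), the probability under `μ^{η±}_Λ` that `x` is joined inside `Λ` by `+`sites to a site
`∗`-adjacent to the outside on or above the axis is at least `θ/2`, where
`θ = μ{x lies in an infinite +∗cluster}` for any `μ ∈ 𝒢(β, 0)`. [cite: GeorgiiHiguchi2000, Lemma 2.3] -/
theorem pointToSemicircuit (hβ : 0 ≤ β) (hΛR : ∀ z, z ∈ Λ ↔ reflectCoord 1 z ∈ Λ)
    (hHF : ∀ z ∉ Λ, FarRight ↑Λ z) (hx : x ∈ Λ) (hx1 : x 1 = 0)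
    {μ : Measure (SpinConfig (Site 2))} (hμ : μ ∈ isingGibbsMeasures 2 β 0) :
    μ.real {ω | (siteCluster zdStarGraph (spinSites 1 ω) x).Infinite} / 2 ≤
      (isingMeasure (zdGraph 2) Λ β 0 (.fixed (pmBC 0))).real {σ | x ∈ kSet Λ σ 1} := by
  classical
  set ρ := isingMeasure (zdGraph 2) Λ β 0 (.fixed (pmBC 0)) with hρ
  set θ := μ.real {ω | (siteCluster zdStarGraph (spinSites 1 ω) x).Infinite} with hθ
  set B : Set (SpinConfig (Site 2)) := {σ | x ∈ kSet Λ σ 1} with hB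
  set C : Set (SpinConfig (Site 2)) := {σ | x ∈ onionDomain Λ σ 1} with hC
  set Bm : Set (SpinConfig (Site 2)) := {σ | x ∈ kSet Λ σ (-1)} with hBm
  set Cm : Set (SpinConfig (Site 2)) := {σ | x ∈ onionDomain Λ σ (-1)} with hCm
  have hBmeas : MeasurableSet B := measurableSet_kSet Λ x 1
  have hCmeas : MeasurableSet C := measurableSet_onionDomain Λ x 1
  have hBmmeas : MeasurableSet Bm := measurableSet_kSet Λ x (-1)
  have hCmmeas : MeasurableSet Cm := measurableSet_onionDomain Λ x (-1)
  have hθ0 : 0 ≤ θ := measureReal_nonneg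
  have hθ1 : θ ≤ 1 := by
    have hμG : IsGibbsMeasure (isingSpecification (zdGraph 2) β 0) μ := hμ
    haveI := hμG.isProbabilityMeasure
    exact measureReal_le_one
  -- the outside is `η±` almost surely
  have hae := ae_isingMeasure_fixed_eq_outside (zdGraph 2) Λ β 0 (pmBC 0)
  have hout : ∀ σ : SpinConfig (Site 2), (∀ z ∉ Λ, σ z = pmBC 0 z) →
      (∀ z ∉ Λ, 0 ≤ z 1 → σ z = 1) ∧ (∀ z ∉ Λ, z 1 < 0 → σ z = -1) := fun σ hσ =>
    ⟨fun z hz h => by rw [hσ z hz, pmBC_of_le h], fun z hz h => by rw [hσ z hz, pmBC_of_lt h]⟩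
  have hxR : reflectCoord 1 x = x := by
    ext i; rw [reflectCoord_apply]; fin_cases i <;> simp [hx1]
  -- (1)+(2): `ρ(B ∪ C) ≥ 1/2`
  have hD : 2⁻¹ ≤ ρ.real (B ∪ C) := by
    have hcover : ∀ᵐ σ ∂ρ, σ ∈ (B ∪ C) ∪ (Bm ∪ Cm) := by
      filter_upwards [hae] with σ hσ
      obtain ⟨hp, hn⟩ := hout σ hσ
      rcases onion_dichotomy' (c := σ) hHF hp hn hx with h | h | h | h
      · exact Or.inl (Or.inl h)
      · exact Or.inr (Or.inl h)
      · exact Or.inl (Or.inr h)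
      · exact Or.inr (Or.inr h)
    have h1 : (1 : ℝ) ≤ ρ.real (B ∪ C) + ρ.real (Bm ∪ Cm) := by
      have hu : ρ.real ((B ∪ C) ∪ (Bm ∪ Cm)) = 1 := by
        have hc : ρ ((B ∪ C) ∪ (Bm ∪ Cm))ᶜ = 0 := ae_iff.1 hcover
        have := (prob_compl_eq_zero_iff ((hBmeas.union hCmeas).union (hBmmeas.union hCmmeas))).1 hc
        simp [measureReal_def, this]
      rw [← hu]
      exact measureReal_union_le _ _
    -- `ρ(Bm ∪ Cm) = ∫ 1_{B ∪ C} ∘ R∘T ≤ ρ(B ∪ C)`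
    have h2 : ρ.real (Bm ∪ Cm) ≤ ρ.real (B ∪ C) := by
      have hpre : ∀ σ : SpinConfig (Site 2), flipRelabel (reflectCoord (d := 2) 1).toEquiv σ ∈ B ∪ C ↔ σ ∈ Bm ∪ Cm := by
        intro σ
        rw [flipRelabel_reflectCoord_one]
        simp only [hB, hC, hBm, hCm, Set.mem_union, Set.mem_setOf_eq]
        rw [mem_kSet_flipReflect_iff hΛR, mem_onionDomain_flipReflect_iff hΛR]
        change (reflectCoord 1 x ∈ kSet Λ σ (-1) ∨ reflectCoord 1 x ∈ onionDomain Λ σ (-1)) ↔ _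
        rw [hxR]
      have hind : (fun σ => (B ∪ C).indicator (1 : SpinConfig (Site 2) → ℝ) (flipRelabel (reflectCoord (d := 2) 1).toEquiv σ)) =
          (Bm ∪ Cm).indicator 1 := by
        funext σ
        simp only [Set.indicator_apply, Pi.one_apply, hpre σ]
      have hup : IsUpperSet (B ∪ C) := isUpperSet_kSet_union_onionDomain Λ x
      have h3 := integral_comp_flipRelabel_le hβ hΛR (monotone_indicator_one_of_isUpperSet hup)
        (measurable_one.indicator (hBmeas.union hCmeas))
      have h4 : ∫ σ, (B ∪ C).indicator (1 : SpinConfig (Site 2) → ℝ) (flipRelabel (reflectCoord (d := 2) 1).toEquiv σ) ∂ρ =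
          ∫ σ, (Bm ∪ Cm).indicator (1 : SpinConfig (Site 2) → ℝ) σ ∂ρ := by rw [← hind]
      rw [h4, integral_indicator_one (hBmmeas.union hCmmeas), integral_indicator_one (hBmeas.union hCmeas)] at h3
      exact h3
    linarith
  -- (3): `ρ(B ∩ C) ≥ θ ρ(C)`, by the Markov property on the random volume
  have hBC : θ * ρ.real C ≤ ρ.real (B ∩ C) := by
    -- the outside event and the partition of `C` over the values `G` of the volume
    set O : Set (SpinConfig (Site 2)) := {σ | ∀ z ∉ Λ, σ z = pmBC 0 z} with hO
    have hOmeas : MeasurableSet O := by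
      have : O = ⋂ z ∈ (↑Λ : Set (Site 2))ᶜ, {σ : SpinConfig (Site 2) | σ z = pmBC 0 z} := by
        ext σ; simp [hO]
      rw [this]
      exact MeasurableSet.biInter (Set.to_countable _) fun z _ => measurableSet_eq_fun (measurable_pi_apply z) measurable_const
    have hOae : ∀ᵐ σ ∂ρ, σ ∈ O := hae
    set E : Finset (Site 2) → Set (SpinConfig (Site 2)) := fun G => {σ | onionDomain Λ σ 1 = G} ∩ O with hE
    have hEdet : ∀ G, ∀ ζ ζ' : SpinConfig (Site 2), (∀ z ∉ G, ζ z = ζ' z) → (ζ ∈ E G ↔ ζ' ∈ E G) := by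
      -- symmetric statement from the one-sided one
      have key : ∀ G, ∀ ζ ζ' : SpinConfig (Site 2), (∀ z ∉ G, ζ z = ζ' z) → ζ ∈ E G → ζ' ∈ E G := by
        rintro G ζ ζ' hζ ⟨hΓ, hζO⟩
        have hGΛ : G ⊆ Λ := by rw [← hΓ]; exact fun g hg => (mem_onionDomain_iff.1 hg).1
        have hζ'O : ζ' ∈ O := fun z hz => by rw [← hζ z (fun h => hz (hGΛ h))]; exact hζO z hz
        obtain ⟨hp, hn⟩ := hout ζ hζO
        refine ⟨?_, hζ'O⟩
        change onionDomain Λ ζ' 1 = G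
        rw [← hΓ]
        exact onionDomain_eq_of_eq_off (c := ζ) hp hn hHF fun v hv => (hζ v (by rw [← hΓ]; exact hv)).symm
      intro G ζ ζ' hζ
      exact ⟨key G ζ ζ' hζ, key G ζ' ζ fun z hz => (hζ z hz).symm⟩
    have hEmeas : ∀ G, MeasurableSet (E G) := fun G => (measurableSet_of_forall_eq_on Λ fun σ σ' h => by
      simp only [Set.mem_setOf_eq, onionDomain_eq_of_eqOn h 1]).inter hOmeas
    -- the kernel bound on `E G` for `x ∈ G`
    have hker : ∀ (G : Finset (Site 2)) (σ : SpinConfig (Site 2)), x ∈ G → σ ∈ E G →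
        ENNReal.ofReal θ ≤ isingMeasure (zdGraph 2) G β 0 (.fixed σ) B := by
      rintro G σ hxG ⟨hΓ, hσO⟩
      change onionDomain Λ σ 1 = G at hΓ
      obtain ⟨hp, hn⟩ := hout σ hσO
      have hGΛ : G ⊆ Λ := by rw [← hΓ]; exact fun g hg => (mem_onionDomain_iff.1 hg).1
      set κ := isingMeasure (zdGraph 2) G β 0 (.fixed σ) with hκ
      -- a.s. under `κ`: `innerConn G x ⊆ B`
      have hsub : ∀ᵐ ζ ∂κ, ζ ∈ innerConn G x → ζ ∈ B := by
        filter_upwards [ae_isingMeasure_fixed_eq_outside (zdGraph 2) G β 0 σ] with ζ hζ hconn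
        obtain ⟨hζx, g, hg, ⟨w, hwG, hgw⟩, hr⟩ := hconn
        have hagree : ∀ v, v ∉ onionDomain Λ σ 1 → ζ v = σ v := fun v hv => hζ v (by rw [← hΓ]; exact hv)
        have hgG : g ∈ onionDomain Λ σ 1 := by rw [hΓ]; exact hg
        have hgΛ : g ∈ Λ := hGΛ hg
        have hζg : ζ g = 1 := by
          obtain ⟨W, hW⟩ := exists_starWalk_of_reachable hr ⟨hζx, Finset.mem_coe.2 hxG⟩
          exact (hW g (Walk.end_mem_support W)).1
        -- `g ∈ kSet Λ ζ 1`
        have hgK : g ∈ kSet Λ ζ 1 := by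
          by_cases hwΛ : w ∈ Λ
          · have hwKσ : w ∈ kSet Λ σ 1 := mem_kSet_of_adj_onionDomain hgG hwΛ (by rwa [hΓ]) hgw
            have hwK : w ∈ kSet Λ ζ 1 := mem_kSet_off_of_mem_kSet (c := σ) hp hn hHF hagree hwKσ (by rwa [hΓ])
            refine mem_kSet_of_reachable hwK hgΛ hζg (Adj.reachable ?_)
            rw [sGraph, siteOpenGraph_adj]
            exact ⟨hgw, ⟨hζg, Finset.mem_coe.2 hgΛ⟩, ⟨hwK.2.1, Finset.mem_coe.2 hwK.1⟩⟩
          · exact mem_kSet_of_adj hgΛ hζg hwΛ (onSide_of_adj_onionDomain hgG hwΛ hgw) hgw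
        -- hence `x ∈ kSet Λ ζ 1`
        refine mem_kSet_of_reachable hgK hx hζx (hr.mono (siteOpenGraph_mono _ fun v hv => ⟨hv.1, ?_⟩))
        exact Finset.mem_coe.2 (hGΛ (Finset.mem_coe.1 hv.2))
      -- `κ(innerConn) ≥ μ^{+}_G(innerConn) ≥ θ`
      have hAm := measurableSet_innerConn G hxG
      have hplus : (isingMeasure (zdGraph 2) G β 0 (.fixed fun _ => 1)).real (innerConn G x) ≤ κ.real (innerConn G x) := by
        have hle : ∀ z ∈ outerBoundary (zdGraph 2) G, (fun _ => (1 : ℤˣ)) z ≤ σ z := by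
          intro z hz
          rw [mem_outerBoundary_iff] at hz
          obtain ⟨hzG, g, hg, hadj⟩ := hz
          have hadj' : zdStarGraph.Adj g z := zdGraph_le_zdStarGraph hadj.symm
          have hgG : g ∈ onionDomain Λ σ 1 := by rw [hΓ]; exact hg
          have hσz : σ z = 1 := by
            by_cases hzΛ : z ∈ Λ
            · exact (mem_kSet_of_adj_onionDomain hgG hzΛ (by rwa [hΓ]) hadj').2.1
            · have h0 := onSide_of_adj_onionDomain hgG hzΛ hadj'
              unfold OnSide at h0
              exact hp z hzΛ (by simpa using h0)
          rw [hσz]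
        have h := isingExpect_fixed_le_of_le_on_outerBoundary (G := zdGraph 2) hβ G 0 hle
          (monotone_indicator_one_of_isUpperSet (isUpperSet_innerConn G x)) (measurable_one.indicator hAm)
          (fun ζ ζ' hζ => by
            by_cases h1 : ζ ∈ innerConn G x
            · rw [Set.indicator_of_mem h1, Set.indicator_of_mem ((innerConn_congr hxG hζ).1 h1)]; rfl
            · rw [Set.indicator_of_notMem h1, Set.indicator_of_notMem (fun h2 => h1 ((innerConn_congr hxG hζ).2 h2))])
        simp only [isingExpect, integral_indicator_one hAm] at h
        exact h
      have hθle : θ ≤ κ.real B :=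
        ((measureReal_infinite_le_isingExpect_plus hβ hμ G hxG).trans hplus).trans
          (ENNReal.toReal_mono (measure_ne_top κ B) (measure_mono_ae hsub))
      exact (ENNReal.ofReal_le_iff_le_toReal (measure_ne_top κ B)).2 hθle
    -- the partition of `C ∩ O` over the values of the volume
    set 𝒢 : Finset (Finset (Site 2)) := Λ.powerset.filter fun G => x ∈ G with h𝒢
    have hmem𝒢 : ∀ G, G ∈ 𝒢 ↔ G ⊆ Λ ∧ x ∈ G := fun G => by rw [h𝒢, Finset.mem_filter, Finset.mem_powerset]
    have hGΛ' : ∀ σ : SpinConfig (Site 2), onionDomain Λ σ 1 ⊆ Λ := fun σ g hg => (mem_onionDomain_iff.1 hg).1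
    have hdecomp : B ∩ C ∩ O = ⋃ G ∈ 𝒢, (E G ∩ B) := by
      ext σ
      simp only [Set.mem_inter_iff, Set.mem_iUnion, exists_prop]
      constructor
      · rintro ⟨⟨hσB, hσC⟩, hσO⟩
        exact ⟨onionDomain Λ σ 1, (hmem𝒢 _).2 ⟨hGΛ' σ, hσC⟩, ⟨rfl, hσO⟩, hσB⟩
      · rintro ⟨G, hG, ⟨hΓ, hσO⟩, hσB⟩
        refine ⟨⟨hσB, ?_⟩, hσO⟩
        change onionDomain Λ σ 1 = G at hΓ
        change x ∈ onionDomain Λ σ 1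
        rw [hΓ]; exact ((hmem𝒢 G).1 hG).2
    have hdecompC : C ∩ O = ⋃ G ∈ 𝒢, E G := by
      ext σ
      simp only [Set.mem_inter_iff, Set.mem_iUnion, exists_prop]
      constructor
      · rintro ⟨hσC, hσO⟩
        exact ⟨onionDomain Λ σ 1, (hmem𝒢 _).2 ⟨hGΛ' σ, hσC⟩, ⟨rfl, hσO⟩⟩
      · rintro ⟨G, hG, ⟨hΓ, hσO⟩⟩
        refine ⟨?_, hσO⟩
        change onionDomain Λ σ 1 = G at hΓ
        change x ∈ onionDomain Λ σ 1
        rw [hΓ]; exact ((hmem𝒢 G).1 hG).2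
    have hdisj : Set.PairwiseDisjoint (↑𝒢 : Set (Finset (Site 2))) E := by
      intro G _ G' _ hne
      rw [Function.onFun, Set.disjoint_iff]
      rintro σ ⟨⟨h1, -⟩, ⟨h2, -⟩⟩
      change onionDomain Λ σ 1 = G at h1
      change onionDomain Λ σ 1 = G' at h2
      exact hne (h1.symm.trans h2)
    have hdisjB : Set.PairwiseDisjoint (↑𝒢 : Set (Finset (Site 2))) fun G => E G ∩ B :=
      hdisj.mono fun G => Set.inter_subset_left
    have hOc : ρ Oᶜ = 0 := ae_iff.1 hOae
    -- the computation in `ℝ≥0∞`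
    have hE : ∀ G ∈ 𝒢, ENNReal.ofReal θ * ρ (E G) ≤ ρ (E G ∩ B) := by
      intro G hG
      have hxG := ((hmem𝒢 G).1 hG).2
      rw [isingMeasure_fixed_inter_eq_lintegral (zdGraph 2) ((hmem𝒢 G).1 hG).1 β 0 (pmBC 0) (hEdet G)
        ((hEmeas G).inter hBmeas), ← lintegral_indicator_const (hEmeas G)]
      refine lintegral_mono fun σ => ?_
      by_cases hσ : σ ∈ E G
      · rw [Set.indicator_of_mem hσ, Set.indicator_of_mem hσ]
        exact hker G σ hxG hσ
      · rw [Set.indicator_of_notMem hσ, Set.indicator_of_notMem hσ]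
    have hmain : ENNReal.ofReal θ * ρ C ≤ ρ (B ∩ C) := by
      have hC' : ρ C = ρ (C ∩ O) := (measure_inter_conull hOc).symm
      have hBC' : ρ (B ∩ C) = ρ (B ∩ C ∩ O) := (measure_inter_conull hOc).symm
      rw [hC', hBC', hdecompC, hdecomp, measure_biUnion_finset hdisj fun G _ => hEmeas G,
        measure_biUnion_finset hdisjB fun G _ => (hEmeas G).inter hBmeas, Finset.mul_sum]
      exact Finset.sum_le_sum hE
    -- back to real numbers
    have := ENNReal.toReal_mono (measure_ne_top ρ _) hmain
    rwa [ENNReal.toReal_mul, ENNReal.toReal_ofReal hθ0] at this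
  -- (4): assembly
  have hsplit : ρ.real (B ∩ C) + ρ.real (B \ C) = ρ.real B := measureReal_inter_add_sdiff₀ hCmeas.nullMeasurableSet
  have hunion : ρ.real (B ∪ C) = ρ.real C + ρ.real (B \ C) := by
    rw [Set.union_comm, ← Set.union_sdiff_self]
    exact measureReal_union Set.disjoint_sdiff_right (hBmeas.diff hCmeas)
  have hdiff0 : 0 ≤ ρ.real (B \ C) := measureReal_nonneg
  calc θ / 2 ≤ θ * ρ.real (B ∪ C) := by nlinarith [hD, hθ0]
    _ = θ * ρ.real C + θ * ρ.real (B \ C) := by rw [hunion]; ring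
    _ ≤ ρ.real (B ∩ C) + ρ.real (B \ C) := add_le_add hBC (by nlinarith [hdiff0, hθ1])
    _ = ρ.real B := hsplit

end Literature.Probability.LatticeModels
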